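import Mathlib
import HarnessLib

/-!
# Crux `EulerZoomLiouville.PowerGaugeEulerLiouville` (stmt-NavierStokesRegularity-19832), weak stratum, line `weak_lagrangian` (ns-idea-11 g9):
# FLOW–TONELLI WITH THE EXACT JACOBIAN LAW — how a regular Lagrangian flow transports null sets, integrals and integrability to a.e. orbit

Route №10 `EulerZoomLiouville` (NavierStokesRegularity), crux E = stmt-NavierStokesRegularity-19832; width seat ns-ezl-w1 g8 under the LEAD ns-typeII-p2 g14.
Stage (A) of the Sobolev half of `stub_chainRule` (F2) of `Lines/weak_lagrangian.lean`, usable by every Lagrangian brick of the line (F2, M2, WL4): for a jointly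
measurable map `Ψ : ℝ → ℝ³ → ℝ³` whose time slices satisfy the JACOBIAN LAW `(Ψ_σ)_# vol = J(σ) • vol` (`σ ≥ 0`; the line has `J(σ) = e^{3γσ}`),

* `quasiMeasurePreserving_slice` — each `Ψ_σ` is quasi-measure-preserving (null sets pull back to null sets); `ae_comp_slice` — a.e. statements transport to
  the label `Ψ_σ y`;
* `lintegral_comp_slice` — `∫ H(Ψ_σ y) dy = J(σ) ∫ H`;
* `lintegral_lintegral_comp` — **flow–Tonelli**: `∫_y ∫_{s ∈ (0,σ]} H(Ψ_s y) ds dy = ∫_{s ∈ (0,σ]} J(s) (∫ H) ds` for measurable `H ≥ 0`;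
* `ae_setLIntegral_comp_lt_top` — if `∫ H < ∞` and `J` is bounded on `[0,σ]`, then for a.e. label `∫_{(0,σ]} H(Ψ_s y) ds < ∞`;
* `ae_ae_comp_of_ae` — a null set of the phase space is met by a.e. orbit only at a null set of times.

WHAT THIS IS NOT: not NS, not E, not F2 — measure-theoretic plumbing `--supports` stmt-19832; 19832 is OPEN. [folklore; AmbrosioCrippa2008 §5 (RLF: compressibility
and transport of integrals)]
-/

noncomputable section

-- flat `Theorems/<Route><Decl>…` files of one crux share the namespace of the crux (tree convention)
set_option linter.dupNamespace false

open MeasureTheory Set Filter Topology Metric Function TopologicalSpace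
open scoped ENNReal NNReal

namespace Summit.NavierStokesRegularity.NavierStokesRegularity.Theorems.PowerGaugeEulerLiouville.WeakLagrangian

section Flow

variable {Ψ : ℝ → EuclideanSpace ℝ (Fin 3) → EuclideanSpace ℝ (Fin 3)} {J : ℝ → ℝ≥0∞}

/-- **A slice with the Jacobian law is quasi-measure-preserving.** [folklore] -/
theorem quasiMeasurePreserving_slice (hΨm : Measurable (Function.uncurry Ψ)) {σ : ℝ}
    (hjac : Measure.map (Ψ σ) (volume : Measure (EuclideanSpace ℝ (Fin 3))) = J σ • (volume : Measure (EuclideanSpace ℝ (Fin 3)))) :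
    Measure.QuasiMeasurePreserving (Ψ σ) volume volume := by
  refine ⟨hΨm.of_uncurry_left, ?_⟩
  rw [hjac]
  exact Measure.smul_absolutelyContinuous

/-- An a.e. property of points holds a.e. at the label `Ψ_σ y`. [folklore] -/
theorem ae_comp_slice (hΨm : Measurable (Function.uncurry Ψ)) {σ : ℝ}
    (hjac : Measure.map (Ψ σ) (volume : Measure (EuclideanSpace ℝ (Fin 3))) = J σ • (volume : Measure (EuclideanSpace ℝ (Fin 3))))
    {q : EuclideanSpace ℝ (Fin 3) → Prop} (h : ∀ᵐ z ∂(volume : Measure (EuclideanSpace ℝ (Fin 3))), q z) :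
    ∀ᵐ y ∂(volume : Measure (EuclideanSpace ℝ (Fin 3))), q (Ψ σ y) :=
  (quasiMeasurePreserving_slice hΨm hjac).ae h

/-- **`∫ H(Ψ_σ y) dy = J(σ) ∫ H`** for measurable `H ≥ 0`. [folklore] -/
theorem lintegral_comp_slice (hΨm : Measurable (Function.uncurry Ψ)) {σ : ℝ}
    (hjac : Measure.map (Ψ σ) (volume : Measure (EuclideanSpace ℝ (Fin 3))) = J σ • (volume : Measure (EuclideanSpace ℝ (Fin 3))))
    {H : EuclideanSpace ℝ (Fin 3) → ℝ≥0∞} (hH : Measurable H) :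
    ∫⁻ y, H (Ψ σ y) = J σ * ∫⁻ z, H z := by
  rw [← lintegral_map hH hΨm.of_uncurry_left, hjac, lintegral_smul_measure, smul_eq_mul]

/-- **FLOW–TONELLI**: `∫_y ∫_{(0,σ]} H(Ψ_s y) ds dy = ∫_{(0,σ]} J(s) ∫H ds` for measurable `H ≥ 0`, when the Jacobian law holds for all `s ≥ 0`. [folklore] -/
theorem lintegral_lintegral_comp (hΨm : Measurable (Function.uncurry Ψ))
    (hjac : ∀ s : ℝ, 0 ≤ s →
      Measure.map (Ψ s) (volume : Measure (EuclideanSpace ℝ (Fin 3))) = J s • (volume : Measure (EuclideanSpace ℝ (Fin 3))))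
    {H : EuclideanSpace ℝ (Fin 3) → ℝ≥0∞} (hH : Measurable H) (σ : ℝ) :
    ∫⁻ y, ∫⁻ s in Ioc 0 σ, H (Ψ s y) = ∫⁻ s in Ioc 0 σ, J s * ∫⁻ z, H z := by
  have hm : AEMeasurable (Function.uncurry fun (y : EuclideanSpace ℝ (Fin 3)) (s : ℝ) => H (Ψ s y))
      ((volume : Measure (EuclideanSpace ℝ (Fin 3))).prod ((volume : Measure ℝ).restrict (Ioc 0 σ))) := by
    have h1 : Measurable fun p : EuclideanSpace ℝ (Fin 3) × ℝ => H (Ψ p.2 p.1) :=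
      hH.comp (hΨm.comp measurable_swap)
    exact h1.aemeasurable
  rw [lintegral_lintegral_swap hm]
  refine setLIntegral_congr_fun measurableSet_Ioc fun s hs => ?_
  exact lintegral_comp_slice hΨm (hjac s hs.1.le) hH

/-- **Integrability along a.e. orbit**: if `∫ H < ∞` and `J ≤ B < ∞` on `[0,σ]`, then for a.e. label `y`, `∫_{(0,σ]} H(Ψ_s y) ds < ∞`. [folklore] -/
theorem ae_setLIntegral_comp_lt_top (hΨm : Measurable (Function.uncurry Ψ))
    (hjac : ∀ s : ℝ, 0 ≤ s →
      Measure.map (Ψ s) (volume : Measure (EuclideanSpace ℝ (Fin 3))) = J s • (volume : Measure (EuclideanSpace ℝ (Fin 3))))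
    {B : ℝ≥0∞} (hB : B ≠ ⊤) {σ : ℝ} (hJ : ∀ s ∈ Icc 0 σ, J s ≤ B)
    {H : EuclideanSpace ℝ (Fin 3) → ℝ≥0∞} (hH : Measurable H) (hHi : ∫⁻ z, H z ≠ ⊤) :
    ∀ᵐ y ∂(volume : Measure (EuclideanSpace ℝ (Fin 3))), ∫⁻ s in Ioc 0 σ, H (Ψ s y) < ⊤ := by
  have hmeas : Measurable fun y : EuclideanSpace ℝ (Fin 3) => ∫⁻ s in Ioc 0 σ, H (Ψ s y) := by
    have h1 : Measurable (Function.uncurry fun (y : EuclideanSpace ℝ (Fin 3)) (s : ℝ) => H (Ψ s y)) :=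
      hH.comp (hΨm.comp measurable_swap)
    exact h1.lintegral_prod_right
  refine ae_lt_top hmeas ?_
  rw [lintegral_lintegral_comp hΨm hjac hH σ]
  refine ne_of_lt (lt_of_le_of_lt ?_ (ENNReal.mul_lt_top (ENNReal.mul_lt_top hB.lt_top hHi.lt_top)
    (measure_Ioc_lt_top (μ := (volume : Measure ℝ)) (a := (0 : ℝ)) (b := σ))))
  calc ∫⁻ s in Ioc 0 σ, J s * ∫⁻ z, H z ≤ ∫⁻ _ in Ioc 0 σ, B * ∫⁻ z, H z := by
        refine setLIntegral_mono measurable_const fun s hs => ?_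
        exact mul_le_mul' (hJ s (Ioc_subset_Icc_self hs)) le_rfl
    _ = B * (∫⁻ z, H z) * volume (Ioc (0 : ℝ) σ) := by rw [setLIntegral_const]

/-- **A null set is met by a.e. orbit only at a null set of times**: if `vol N = 0` then for a.e. `y`, `Ψ_s y ∉ N` for a.e. `s ∈ (0,σ]`. [folklore] -/
theorem ae_ae_notMem_of_null (hΨm : Measurable (Function.uncurry Ψ))
    (hjac : ∀ s : ℝ, 0 ≤ s →
      Measure.map (Ψ s) (volume : Measure (EuclideanSpace ℝ (Fin 3))) = J s • (volume : Measure (EuclideanSpace ℝ (Fin 3))))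
    {N : Set (EuclideanSpace ℝ (Fin 3))} (hN : MeasurableSet N) (hN0 : volume N = 0) (σ : ℝ) :
    ∀ᵐ y ∂(volume : Measure (EuclideanSpace ℝ (Fin 3))), ∀ᵐ s ∂((volume : Measure ℝ).restrict (Ioc 0 σ)), Ψ s y ∉ N := by
  have hH : Measurable (N.indicator (fun _ => (1 : ℝ≥0∞))) := measurable_const.indicator hN
  have hzero : ∫⁻ y, ∫⁻ s in Ioc 0 σ, N.indicator (fun _ => (1 : ℝ≥0∞)) (Ψ s y) = 0 := by
    rw [lintegral_lintegral_comp hΨm hjac hH σ, lintegral_indicator hN, setLIntegral_const, hN0]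
    simp
  have hmeas : Measurable fun y : EuclideanSpace ℝ (Fin 3) => ∫⁻ s in Ioc 0 σ, N.indicator (fun _ => (1 : ℝ≥0∞)) (Ψ s y) := by
    have h1 : Measurable (Function.uncurry fun (y : EuclideanSpace ℝ (Fin 3)) (s : ℝ) => N.indicator (fun _ => (1 : ℝ≥0∞)) (Ψ s y)) :=
      hH.comp (hΨm.comp measurable_swap)
    exact h1.lintegral_prod_right
  have hae := (lintegral_eq_zero_iff hmeas).1 hzero
  filter_upwards [hae] with y hy
  have hmeas' : Measurable fun s : ℝ => N.indicator (fun _ => (1 : ℝ≥0∞)) (Ψ s y) := hH.comp hΨm.of_uncurry_right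
  have h2 := (lintegral_eq_zero_iff hmeas').1 hy
  filter_upwards [h2] with s hs
  intro hmem
  simp [indicator_of_mem hmem] at hs

/-- Consequence: an a.e. property of points holds, for a.e. label, at a.e. time along the orbit. [folklore] -/
theorem ae_ae_comp_of_ae (hΨm : Measurable (Function.uncurry Ψ))
    (hjac : ∀ s : ℝ, 0 ≤ s →
      Measure.map (Ψ s) (volume : Measure (EuclideanSpace ℝ (Fin 3))) = J s • (volume : Measure (EuclideanSpace ℝ (Fin 3))))
    {q : EuclideanSpace ℝ (Fin 3) → Prop} (h : ∀ᵐ z ∂(volume : Measure (EuclideanSpace ℝ (Fin 3))), q z) (σ : ℝ) :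
    ∀ᵐ y ∂(volume : Measure (EuclideanSpace ℝ (Fin 3))), ∀ᵐ s ∂((volume : Measure ℝ).restrict (Ioc 0 σ)), q (Ψ s y) := by
  obtain ⟨N, hNsub, hN, hN0⟩ := exists_measurable_superset_of_null (ae_iff.1 h)
  filter_upwards [ae_ae_notMem_of_null hΨm hjac hN hN0 σ] with y hy
  filter_upwards [hy] with s hs
  by_contra hq
  exact hs (hNsub hq)

end Flow

end Summit.NavierStokesRegularity.NavierStokesRegularity.Theorems.PowerGaugeEulerLiouville.WeakLagrangian

end
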